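import Mathlib
import HarnessLib
import Literature.Analysis.FluidPDE.TsaiLocalEnergy
import Summits.NavierStokesRegularity.NavierStokesRegularity.Theorems.LrcModEntire.Negative.ThickColumnWindow

/-!
# Crux K2 `PoloidalWindowRigidity` (stmt-NavierStokesRegularity-19708) — negative lemma: `stub_hyperbolicThick` of
# skeleton mixed_type v1 (sha16 d09dd930174f060f) is FALSE WITHOUT the Oseen-mild hypothesis (M)

Negative-side lemma (refuter seat ns-regularity-refuter1, KILLSHEET K-50; D-0081 §C).  Skeleton mixed_type v1
(`Cruxes/PoloidalWindowRigidity/Lines/mixed_type.lean`) re-types the research residue of K2 as `stub_hyperbolicThick`: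
class (R)(C)(M)(D)(P) and, on a non-empty open window, non-degeneracy + the time-only slope pin + twisting + HYPERBOLIC
type (`∂₂v₀·∂₀v₂ + ∂₂v₁·∂₁v₂ < 0` pointwise) + the THICK clause (the shear slope is a function of `(t, x₂)` on NO non-empty
open subset) ⇒ `¬ IsBackwardSingularPoint v 0`.  Its docstring records that «the (M)-free hyperbolic witnesses of the tree
all have CONSTANT ratio `Λ ≡ −1`, excluded here by the pin and by thickness».

THIS FILE supplies the missing (M)-free witness ON THE THICK HYPERBOLIC STRATUM: the statement of `stub_hyperbolicThick`
with (M) deleted — everything else VERBATIM — is false (`hyperbolicThick_false_without_mild`), and stays false with (M)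
replaced by real-analyticity (A) of every slice (`hyperbolicThick_false_without_mild_analytic`).  Witness: the thick
column `…LrcModEntire.Negative.thickProfile`, `v(t, x) = (−t)^{-1/2}(sin x₂ sin x₀, 2 sin 2x₂ sin x₁, cos x₂ cos x₀ +
cos 2x₂ cos x₁)` on `…thickWindow`: its two vertical modes have slope RATIOS `−1` and `−4` (so no slope function of any
kind exists anywhere: pin and THICK clause hold; the type scalar is `−(−t)^{-1}(P² sin² x₀ + 4Q² sin² x₁) < 0`:
HYPERBOLIC), the twist bracket is non-zero, and `v(t, 0) = (0, 0, 2(−t)^{-1/2})` makes the apex backward-singular.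
The witness is NOT frozen (`…LrcModEntire.Negative.frozen_defect_thickProfile`): any proof of `stub_hyperbolicThick` must
use (M), possibly already through the frozen vorticity law.  Companions: `…Negative.TwistingFalseWithoutMild` (lrc-jet v5
`stub_twisting` ∖ (M), (TH) column), `…LrcModEntire.Negative.TwistingThickFalseWithoutMild` (twist-split's `stub_twistingThick`
∖ (M), same witness).
WHAT THIS IS NOT: not a claim about Navier–Stokes regularity and not a refutation of K2 (whose class includes (M)) — a
kernel-checked record of which hypothesis of the residual stub is load-bearing. [folklore]
-/

noncomputable section

-- the summit and its single sub-problem share the name (CONVENTIONS §1), as in every Theorems file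
set_option linter.dupNamespace false

namespace Summit.NavierStokesRegularity.NavierStokesRegularity.Theorems.PoloidalWindowRigidity.Negative

open MeasureTheory Set Function Filter Topology Metric
open scoped RealInnerProductSpace InnerProductSpace
open Literature.Analysis Literature.Analysis.FluidPDE
open Summit.NavierStokesRegularity.NavierStokesRegularity.Theorems.LrcModEntire.Negative

local notation "E3" => EuclideanSpace ℝ (Fin 3)
local notation "𝐞" i => (EuclideanSpace.single (i : Fin 3) (1 : ℝ) : EuclideanSpace ℝ (Fin 3))

/-- **The thick column window is HYPERBOLIC**: `∂₂v₀·∂₀v₂ + ∂₂v₁·∂₁v₂ = −(−t)^{-1}(P² sin² x₀ + 4Q² sin² x₁) < 0`.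
[folklore] -/
theorem thickProfile_hyperbolic (z : ℝ × E3) (hz : z ∈ thickWindow) :
    fderiv ℝ (thickProfile z.1) z.2 (𝐞 2) 0 * fderiv ℝ (thickProfile z.1) z.2 (𝐞 0) 2 +
      fderiv ℝ (thickProfile z.1) z.2 (𝐞 2) 1 * fderiv ℝ (thickProfile z.1) z.2 (𝐞 1) 2 < 0 := by
  obtain ⟨ht, hx0, hx0', -, -, hx2, hx2'⟩ := mem_thickWindow hz
  have ha : 0 < cellAmp z.1 * (thickP (z.2 2) * Real.sin (z.2 0)) :=
    mul_pos (cellAmp_pos ht) (mul_pos (thickP_pos hx2 hx2') (Real.sin_pos_of_pos_of_lt_pi hx0 hx0'))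
  rw [fderiv_thickProfile_e2_apply_zero, fderiv_thickProfile_e0_apply_two, fderiv_thickProfile_e2_apply_one,
    fderiv_thickProfile_e1_apply_two]
  nlinarith [sq_nonneg (cellAmp z.1 * (thickQ (z.2 2) * Real.sin (z.2 1))), mul_pos ha ha]

/-- The vertical velocity: `v₂(t, x) = (−t)^{-1/2} (P(x₂) cos x₀ + Q(x₂) cos x₁)`. [folklore] -/
theorem thickProfile_apply_two (t : ℝ) (x : E3) :
    thickProfile t x 2 = cellAmp t * (thickP (x 2) * Real.cos (x 0) + thickQ (x 2) * Real.cos (x 1)) := by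
  simp only [thickProfile, PiLp.smul_apply, smul_eq_mul, thickField_apply_two]

/-- **The thick column profile is backward-singular at the apex**: `v(t, 0) = (0, 0, 2(−t)^{-1/2})` exceeds every
level for `t → 0⁻`, and continuity gives essential unboundedness on every parabolic cylinder `Q_r(0, 0)`
(`isBackwardSingularPoint_of_forall_exists_continuousAt`). [folklore] -/
theorem isBackwardSingularPoint_thickProfile : IsBackwardSingularPoint thickProfile 0 := by
  apply isBackwardSingularPoint_of_forall_exists_continuousAt
  intro r hr M
  set K : ℝ := |M| + 1 with hKdef
  have hK : 0 < K := by positivity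
  have hMK : M < K := by rw [hKdef]; linarith [le_abs_self M]
  set τ : ℝ := min (r ^ 2 / 2) ((1 / (3 * K)) ^ 2 / 2) with hτdef
  have h3K : 0 < 1 / (3 * K) := by positivity
  have hτpos : 0 < τ := lt_min (by positivity) (by positivity)
  have hτr : τ < r ^ 2 := lt_of_le_of_lt (min_le_left _ _) (by nlinarith)
  have hτK : τ < (1 / (3 * K)) ^ 2 := lt_of_le_of_lt (min_le_right _ _) (by nlinarith)
  have hsqrt : Real.sqrt τ < 1 / (3 * K) := by
    rw [Real.sqrt_lt' h3K]
    exact hτK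
  have hsqrtpos : 0 < Real.sqrt τ := Real.sqrt_pos.2 hτpos
  have hamp : cellAmp (-τ) = (Real.sqrt τ)⁻¹ := by simp [cellAmp]
  refine ⟨((-τ : ℝ), (0 : E3)), ?_, ?_, ?_⟩
  · rw [mem_parabolicCylinder]
    refine ⟨⟨?_, ?_⟩, ?_⟩
    · simp only [Prod.fst_zero]; linarith
    · simp only [Prod.fst_zero]; linarith
    · simp only [Prod.snd_zero, dist_self]; exact hr
  · exact continuousOn_thickProfile.continuousAt
      ((isOpen_Iio.prod isOpen_univ).mem_nhds ⟨by simp [hτpos], Set.mem_univ _⟩)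
  · have hcomp : thickProfile (-τ) 0 2 = (Real.sqrt τ)⁻¹ * 2 := by
      rw [thickProfile_apply_two, hamp, PiLp.zero_apply, PiLp.zero_apply, PiLp.zero_apply, Real.cos_zero,
        thickP_zero, thickQ_zero]
      ring
    have hlow : (Real.sqrt τ)⁻¹ * 2 ≤ ‖thickProfile (-τ) 0‖ := by
      calc (Real.sqrt τ)⁻¹ * 2 = |thickProfile (-τ) 0 2| := by
            rw [hcomp, abs_of_nonneg]
            positivity
        _ = ‖thickProfile (-τ) 0 2‖ := (Real.norm_eq_abs _).symm
        _ ≤ ‖thickProfile (-τ) 0‖ := PiLp.norm_apply_le _ 2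
    have hKlt : K < (Real.sqrt τ)⁻¹ * (1 / 3) := by
      rw [← div_eq_inv_mul, lt_div_iff₀ hsqrtpos]
      calc K * Real.sqrt τ < K * (1 / (3 * K)) := mul_lt_mul_of_pos_left hsqrt hK
        _ = 1 / 3 := by field_simp
    have hmono : (Real.sqrt τ)⁻¹ * (1 / 3) ≤ (Real.sqrt τ)⁻¹ * 2 :=
      mul_le_mul_of_nonneg_left (by norm_num) (inv_nonneg.2 (Real.sqrt_nonneg _))
    show M < ‖thickProfile (-τ) 0‖
    linarith

/-- **`stub_hyperbolicThick` of skeleton mixed_type v1 is FALSE without the Oseen-mild identity (M).**  The hypotheses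
are those of `stub_hyperbolicThick` VERBATIM with (M) deleted; the thick column (`C = 10`, window `thickWindow`)
satisfies all of them — non-degenerate, time-only pin and THICK clause (no slope exists anywhere), twisting, hyperbolic —
and is backward-singular at the apex. [folklore] -/
theorem hyperbolicThick_false_without_mild :
    ¬ (∀ (C : ℝ) (v : ℝ → EuclideanSpace ℝ (Fin 3) → EuclideanSpace ℝ (Fin 3)),
      Literature.Analysis.FluidPDE.HasTypeITimeDecay C v →
      ContinuousOn (Function.uncurry v) (Set.Iio (0 : ℝ) ×ˢ Set.univ) →
      (∀ t < 0, Literature.Analysis.FluidPDE.VectorCalculus.IsDivFree (v t)) →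
      (∀ s < 0, ∀ y, ⟪Literature.Analysis.FluidPDE.curl (v s) y, EuclideanSpace.single 2 1⟫_ℝ = 0) →
      ∀ W : Set (ℝ × EuclideanSpace ℝ (Fin 3)), IsOpen W → W.Nonempty → W ⊆ Set.Iio (0 : ℝ) ×ˢ Set.univ →
        (∀ z ∈ W, Literature.Analysis.FluidPDE.curl (v z.1) z.2 ≠ 0 ∧
          (fderiv ℝ (v z.1) z.2 (EuclideanSpace.single 0 1) 2 ≠ 0 ∨ fderiv ℝ (v z.1) z.2 (EuclideanSpace.single 1 1) 2 ≠ 0) ∧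
          (fderiv ℝ (v z.1) z.2 (EuclideanSpace.single 2 1) 0 ≠ 0 ∨ fderiv ℝ (v z.1) z.2 (EuclideanSpace.single 2 1) 1 ≠ 0)) →
        (∀ m : ℝ → ℝ, ∀ W₁ : Set (ℝ × EuclideanSpace ℝ (Fin 3)), W₁ ⊆ W → IsOpen W₁ → W₁.Nonempty →
          ∃ z ∈ W₁, ∃ b : Fin 3, b ≠ 2 ∧
            fderiv ℝ (v z.1) z.2 (EuclideanSpace.single 2 1) b ≠
              m z.1 * fderiv ℝ (v z.1) z.2 (EuclideanSpace.single b 1) 2) →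
        (∀ z ∈ W,
          fderiv ℝ (fun x => fderiv ℝ (v z.1) x (EuclideanSpace.single 2 1) 2) z.2 (EuclideanSpace.single 0 1) *
              fderiv ℝ (v z.1) z.2 (EuclideanSpace.single 1 1) 2 -
            fderiv ℝ (fun x => fderiv ℝ (v z.1) x (EuclideanSpace.single 2 1) 2) z.2 (EuclideanSpace.single 1 1) *
              fderiv ℝ (v z.1) z.2 (EuclideanSpace.single 0 1) 2 ≠ 0) →
        (∀ z ∈ W,
          fderiv ℝ (v z.1) z.2 (EuclideanSpace.single 2 1) 0 * fderiv ℝ (v z.1) z.2 (EuclideanSpace.single 0 1) 2 +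
            fderiv ℝ (v z.1) z.2 (EuclideanSpace.single 2 1) 1 * fderiv ℝ (v z.1) z.2 (EuclideanSpace.single 1 1) 2 < 0) →
        (∀ m : ℝ → ℝ → ℝ, ∀ W₁ : Set (ℝ × EuclideanSpace ℝ (Fin 3)), W₁ ⊆ W → IsOpen W₁ → W₁.Nonempty →
          ∃ z ∈ W₁, ∃ b : Fin 3, b ≠ 2 ∧
            fderiv ℝ (v z.1) z.2 (EuclideanSpace.single 2 1) b ≠
              m z.1 (z.2 2) * fderiv ℝ (v z.1) z.2 (EuclideanSpace.single b 1) 2) →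
        ¬ Literature.Analysis.FluidPDE.IsBackwardSingularPoint v 0) := by
  intro H
  exact H 10 thickProfile hasTypeITimeDecay_thickProfile continuousOn_thickProfile
    (fun t _ => isDivFree_thickProfile t) (fun s _ y => poloidal_thickProfile s y) thickWindow isOpen_thickWindow
    thickWindow_nonempty thickWindow_subset thickProfile_pins
    (fun m W₁ hW₁ _ hW₁n => thickProfile_slope_clause_time m W₁ hW₁ hW₁n) thickProfile_twist_ne_zero
    thickProfile_hyperbolic (fun m W₁ hW₁ _ hW₁n => thickProfile_slope_clause_timeHeight m W₁ hW₁ hW₁n)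
    isBackwardSingularPoint_thickProfile

/-- **… and FALSE with (M) replaced by real-analyticity (A) of every slice** (the witness is entire; it is NOT frozen, so
(F) cannot be added here — see `…LrcModEntire.Negative.frozen_defect_thickProfile`). [folklore] -/
theorem hyperbolicThick_false_without_mild_analytic :
    ¬ (∀ (C : ℝ) (v : ℝ → EuclideanSpace ℝ (Fin 3) → EuclideanSpace ℝ (Fin 3)),
      Literature.Analysis.FluidPDE.HasTypeITimeDecay C v →
      ContinuousOn (Function.uncurry v) (Set.Iio (0 : ℝ) ×ˢ Set.univ) →
      (∀ t < 0, Literature.Analysis.FluidPDE.VectorCalculus.IsDivFree (v t)) →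
      (∀ s < 0, ∀ y, ⟪Literature.Analysis.FluidPDE.curl (v s) y, EuclideanSpace.single 2 1⟫_ℝ = 0) →
      (∀ s < 0, AnalyticOnNhd ℝ (v s) Set.univ) →
      ∀ W : Set (ℝ × EuclideanSpace ℝ (Fin 3)), IsOpen W → W.Nonempty → W ⊆ Set.Iio (0 : ℝ) ×ˢ Set.univ →
        (∀ z ∈ W, Literature.Analysis.FluidPDE.curl (v z.1) z.2 ≠ 0 ∧
          (fderiv ℝ (v z.1) z.2 (EuclideanSpace.single 0 1) 2 ≠ 0 ∨ fderiv ℝ (v z.1) z.2 (EuclideanSpace.single 1 1) 2 ≠ 0) ∧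
          (fderiv ℝ (v z.1) z.2 (EuclideanSpace.single 2 1) 0 ≠ 0 ∨ fderiv ℝ (v z.1) z.2 (EuclideanSpace.single 2 1) 1 ≠ 0)) →
        (∀ m : ℝ → ℝ, ∀ W₁ : Set (ℝ × EuclideanSpace ℝ (Fin 3)), W₁ ⊆ W → IsOpen W₁ → W₁.Nonempty →
          ∃ z ∈ W₁, ∃ b : Fin 3, b ≠ 2 ∧
            fderiv ℝ (v z.1) z.2 (EuclideanSpace.single 2 1) b ≠
              m z.1 * fderiv ℝ (v z.1) z.2 (EuclideanSpace.single b 1) 2) →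
        (∀ z ∈ W,
          fderiv ℝ (fun x => fderiv ℝ (v z.1) x (EuclideanSpace.single 2 1) 2) z.2 (EuclideanSpace.single 0 1) *
              fderiv ℝ (v z.1) z.2 (EuclideanSpace.single 1 1) 2 -
            fderiv ℝ (fun x => fderiv ℝ (v z.1) x (EuclideanSpace.single 2 1) 2) z.2 (EuclideanSpace.single 1 1) *
              fderiv ℝ (v z.1) z.2 (EuclideanSpace.single 0 1) 2 ≠ 0) →
        (∀ z ∈ W,
          fderiv ℝ (v z.1) z.2 (EuclideanSpace.single 2 1) 0 * fderiv ℝ (v z.1) z.2 (EuclideanSpace.single 0 1) 2 +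
            fderiv ℝ (v z.1) z.2 (EuclideanSpace.single 2 1) 1 * fderiv ℝ (v z.1) z.2 (EuclideanSpace.single 1 1) 2 < 0) →
        (∀ m : ℝ → ℝ → ℝ, ∀ W₁ : Set (ℝ × EuclideanSpace ℝ (Fin 3)), W₁ ⊆ W → IsOpen W₁ → W₁.Nonempty →
          ∃ z ∈ W₁, ∃ b : Fin 3, b ≠ 2 ∧
            fderiv ℝ (v z.1) z.2 (EuclideanSpace.single 2 1) b ≠
              m z.1 (z.2 2) * fderiv ℝ (v z.1) z.2 (EuclideanSpace.single b 1) 2) →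
        ¬ Literature.Analysis.FluidPDE.IsBackwardSingularPoint v 0) := by
  intro H
  exact H 10 thickProfile hasTypeITimeDecay_thickProfile continuousOn_thickProfile
    (fun t _ => isDivFree_thickProfile t) (fun s _ y => poloidal_thickProfile s y)
    (fun s _ => analyticOnNhd_thickProfile s) thickWindow isOpen_thickWindow
    thickWindow_nonempty thickWindow_subset thickProfile_pins
    (fun m W₁ hW₁ _ hW₁n => thickProfile_slope_clause_time m W₁ hW₁ hW₁n) thickProfile_twist_ne_zero
    thickProfile_hyperbolic (fun m W₁ hW₁ _ hW₁n => thickProfile_slope_clause_timeHeight m W₁ hW₁ hW₁n)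
    isBackwardSingularPoint_thickProfile

end Summit.NavierStokesRegularity.NavierStokesRegularity.Theorems.PoloidalWindowRigidity.Negative

end
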